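import Summits.Ventures.Crystal3D.Theorems.StickyWulffConstantCoaxialWallLawPayerTwinTwoPlateRow
import Summits.Ventures.Crystal3D.Theorems.StickyWulffConstantCoaxialWallLawPayerTransPlaneRow
import Summits.Ventures.Crystal3D.Theorems.StickyWulffConstantCoaxialWallLawPayerUnionTwoPlate
import Summits.Ventures.Crystal3D.Theorems.StickyWulffConstantCoaxialWallLawTriadicRegistryCoaxial
import Summits.Ventures.Crystal3D.Theorems.StickyWulffConstantCoaxialWallLawOfCensus
import HarnessLib

/-!
# THE CRUX `CoaxialWallLaw` MODULO THE NAMED CENSUS ROWS (and E1, `StarPairFar` for the hole cosets)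

HONEST FRAMING. Venture `Summits/Ventures/Crystal3D` (cell `crystal3d-full`), helper `--supports` the crux
`CoaxialWallLaw` (stmt-Ventures-19481, `route-Ventures-StickyWulffConstant`), REGISTERED line `WallLedgerF` (planner
cf-p1), open stub `stub_coaxialTwoSlabAdhesion`.  Rung credit; F-C1 not moved; NOT the stub: the result is CONDITIONAL on
NAMED facts.  STEP-2 of DECISION (xxxiii) (19481-p2 g6), the last glue file: the union of

* twins — `coaxialTwoSlabAdhesion_general_twin_of_row` (`…PayerTwinTwoPlateRow`): `½·sin θ` modulo the twin rows;
* translations, trichotomy `skew_trichotomy_fin` on the cubic coordinates of the offset `τ = A₁⁻¹(t₂ − t₁) ∉ Λ₀`: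
  (A) all integral (hole cosets) — non-triadic (`not_pow_three_smul_mem_of_classA`), hence FREE at `c₀ = 1`:
  `coaxialTwoSlabAdhesion_of_not_triadic` (cf-p1 g10, `…TriadicRegistryCoaxial`; modulo `ExactOnly`(C12-55) = E1 and
  `StarPairFar`); (B) a doubly skew cubic axis — `translate_twoSlabAdhesion_axis_row`; (C) a skew `{111}` plane —
  `coaxialTwoSlabAdhesion_trans_skew_row` (both `(√6/s_F)·sin θ' ≥ ½·sin θ'` for `s_F ≤ 2√6`).

* `localEndRow_mono` (the row is antitone in the root sets), `localEndRow_of_endRowTrans6`;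
* `coaxialTwoSlabAdhesion_translate_row`, **`coaxialTwoSlabAdhesion_of_rows : … → CoaxialTwoSlabAdhesion`** (the stub's
  statement BY NAME), **`coaxialWallLaw_of_rows : … → CoaxialWallLaw`** (the crux BY NAME, via
  `coaxialWallLaw_of_stubProps` and `stub_affineSampleDeficit`), **`coaxialWallLaw_of_endRows`** (the same with the
  translation rows as the census Props `EndRowTrans v1 s_F`, `EndRowTrans6 v1 s_F` of `…EndRowDefs` BY NAME).

INPUTS BY NAME (all hypotheses; none is proved here): `KissingGap δ`, `KissingClassification δ` (admissible literature
facts); `ExactOnly 0 (polar cap of s₀)` [E1, C12-55] and `StarPairFar` [certified computation] for class (A); and THE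
CENSUS ROWS with ONE constant `0 < s_F ≤ 2√6` (`LocalEndRow v1 s_F`, `…EndRowDefs`): (twins) for every frame `L`, the
systems `⟨L, rising in-plane roots⟩ / ⟨(ℝ∙e₃).reflection ∘ L, falling in-plane roots⟩`; (C) for every frame `L'`, the
systems `⟨L', inPlaneRoots L' 1⟩ / ⟨L', inPlaneRoots L' (−1)⟩` (= `EndRowTrans v1 s_F`); (B) for every frame `G` and
every family `RT` of rising slots, `⟨G, RT⟩ / ⟨G, −RT⟩` (implied by the all-roots row by monotonicity of `LocalEndRow`
in the root sets).  The rows are finite local statements about 1-separated sets in the ball of radius 3 — the object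
of cf-p2's census certificate (row (F-twin) of the calibration memo F-CALIB-g6: v1 two-plate threshold `2√6 ≈ 4.90`).

WHAT THIS IS NOT.  Not a proof of any row, of E1 or of `StarPairFar`; the theorem is the crux CONDITIONALLY on them;
F-C1 not moved.
-/

noncomputable section

namespace Summit.Ventures.Crystal3D.Theorems

open Summit.Ventures.Crystal3D Finset
open Summit.Ventures.Crystal3D.Cruxes.CoaxialWallLaw.WallLedgerF (AffineSampleDeficit CoaxialTwoSlabAdhesion)
open Literature.MathematicalPhysics.StatisticalMechanics (fccStacking barlowStacking IsHaggSeq constHagg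
  isHaggSeq_const contactDeficiency)
open scoped InnerProductSpace

/-- **`LocalEndRow` is antitone in the root sets** (same frames): more roots give more admissible classes, more end
pairs, larger multiplicities over the same pooled deficiencies. -/
theorem localEndRow_mono {v : WordVersion} {sF : ℝ}
    {G₁ G₂ : EuclideanSpace ℝ (Fin 3) ≃ₗᵢ[ℝ] EuclideanSpace ℝ (Fin 3)}
    {RT₁ RT₁' RT₂ RT₂' : Finset (EuclideanSpace ℝ (Fin 3))} (h₁ : RT₁ ⊆ RT₁') (h₂ : RT₂ ⊆ RT₂')
    (h : LocalEndRow v sF ⟨G₁, RT₁'⟩ ⟨G₂, RT₂'⟩) : LocalEndRow v sF ⟨G₁, RT₁⟩ ⟨G₂, RT₂⟩ := by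
  classical
  intro X hX z hz hdeg
  have hFw : ∀ (S S' : PlateSystem), S.G₀ = S'.G₀ → ∀ κ, S.Fw κ = S'.Fw κ := by
    intro S S' hSS κ
    induction κ with
    | nil => simp only [PlateSystem.Fw, hSS]
    | cons μ κ ih => simp only [PlateSystem.Fw, ih]
  have e₁ := hFw ⟨G₁, RT₁⟩ ⟨G₁, RT₁'⟩ rfl
  have e₂ := hFw ⟨G₂, RT₂⟩ ⟨G₂, RT₂'⟩ rfl
  have hEP : ∀ b q, IsEndPair X v ⟨G₁, RT₁⟩ ⟨G₂, RT₂⟩ b q → IsEndPair X v ⟨G₁, RT₁'⟩ ⟨G₂, RT₂'⟩ b q := by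
    rintro b q ⟨hq, hb, h2, G, d, hadm, hem⟩
    refine ⟨hq, hb, h2, G, d, ?_, hem⟩
    rcases hadm with ⟨r, hr, κ, hWF, hG, hd⟩ | ⟨r, hr, κ, hWF, hG, hd⟩
    · exact Or.inl ⟨r, h₁ hr, κ, hWF, by rw [hG, e₁], by rw [hd, e₁]⟩
    · exact Or.inr ⟨r, h₂ hr, κ, hWF, by rw [hG, e₂], by rw [hd, e₂]⟩
  have hmult : ∀ b, endMult X v ⟨G₁, RT₁⟩ ⟨G₂, RT₂⟩ b ≤ endMult X v ⟨G₁, RT₁'⟩ ⟨G₂, RT₂'⟩ b := by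
    intro b
    unfold endMult
    exact card_le_card fun q hq => by
      rw [mem_filter] at hq ⊢
      exact ⟨hq.1, hEP b q hq.2⟩
  have hpd : ∀ b, 0 ≤ pooledDef X b := by
    intro b
    unfold pooledDef
    refine sum_nonneg fun w hw => ?_
    have h11 : ((X.filter fun q => dist w q = 1).card : ℝ) ≤ 11 := by exact_mod_cast (mem_filter.1 hw).2.2
    linarith
  have hterm : ∀ b, (endMult X v ⟨G₁, RT₁⟩ ⟨G₂, RT₂⟩ b : ℝ) / pooledDef X b ≤
      (endMult X v ⟨G₁, RT₁'⟩ ⟨G₂, RT₂'⟩ b : ℝ) / pooledDef X b := fun b =>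
    div_le_div_of_nonneg_right (by exact_mod_cast hmult b) (hpd b)
  calc ∑ b ∈ X.filter (fun b => dist z b ≤ 1 ∧ 0 < endMult X v ⟨G₁, RT₁⟩ ⟨G₂, RT₂⟩ b),
        (endMult X v ⟨G₁, RT₁⟩ ⟨G₂, RT₂⟩ b : ℝ) / pooledDef X b
      ≤ ∑ b ∈ X.filter (fun b => dist z b ≤ 1 ∧ 0 < endMult X v ⟨G₁, RT₁⟩ ⟨G₂, RT₂⟩ b),
        (endMult X v ⟨G₁, RT₁'⟩ ⟨G₂, RT₂'⟩ b : ℝ) / pooledDef X b := sum_le_sum fun b _ => hterm b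
    _ ≤ ∑ b ∈ X.filter (fun b => dist z b ≤ 1 ∧ 0 < endMult X v ⟨G₁, RT₁'⟩ ⟨G₂, RT₂'⟩ b),
        (endMult X v ⟨G₁, RT₁'⟩ ⟨G₂, RT₂'⟩ b : ℝ) / pooledDef X b := by
        refine sum_le_sum_of_subset_of_nonneg (fun b hb => ?_) fun b _ _ => div_nonneg (Nat.cast_nonneg _) (hpd b)
        obtain ⟨hbX, hd, hm⟩ := mem_filter.1 hb
        exact mem_filter.2 ⟨hbX, hd, lt_of_lt_of_le hm (hmult b)⟩
    _ ≤ sF := h X hX z hz hdeg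

/-- The all-roots row `EndRowTrans6` gives the row for EVERY rising root family of every frame (monotonicity). -/
theorem localEndRow_of_endRowTrans6 {v : WordVersion} {sF : ℝ} (h6 : EndRowTrans6 v sF)
    (G : EuclideanSpace ℝ (Fin 3) ≃ₗᵢ[ℝ] EuclideanSpace ℝ (Fin 3)) (RT : Finset (EuclideanSpace ℝ (Fin 3)))
    (hRT : ∀ r ∈ RT, r ∈ fccSlots ∧ 0 < (G r) 2) :
    LocalEndRow v sF ⟨G, RT⟩ ⟨G, RT.image (fun r : EuclideanSpace ℝ (Fin 3) => -r)⟩ := by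
  refine localEndRow_mono (fun r hr => ?_) (fun r' hr' => ?_) (h6 G)
  · exact mem_filter.2 ⟨(hRT r hr).1, by rw [one_mul]; exact (hRT r hr).2⟩
  · obtain ⟨r, hr, rfl⟩ := mem_image.1 hr'
    refine mem_filter.2 ⟨neg_mem_fccSlots (hRT r hr).1, ?_⟩
    rw [map_neg, PiLp.neg_apply]
    have := (hRT r hr).2
    linarith

section Rows

variable {δ : ℝ} (hg : KissingGap δ) (hc : KissingClassification δ)
variable {s₀ : EuclideanSpace ℝ (Fin 3)} (hs₀ : s₀ ∈ fccSlots)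
  (hcert : ExactOnly 0 (fccSlots.filter fun w => 0 < ⟪w, s₀⟫_ℝ)) (hfar : StarPairFar)
variable {sF : ℝ} (hsF : 0 < sF) (hsF' : sF ≤ 2 * Real.sqrt 6)
  (hrowW : ∀ L : EuclideanSpace ℝ (Fin 3) ≃ₗᵢ[ℝ] EuclideanSpace ℝ (Fin 3),
    LocalEndRow WordVersion.v1 sF ⟨L, inPlaneRoots L 1⟩
      ⟨((ℝ ∙ (EuclideanSpace.single (2 : Fin 3) (1 : ℝ))).reflection).trans L,
        inPlaneRoots (((ℝ ∙ (EuclideanSpace.single (2 : Fin 3) (1 : ℝ))).reflection).trans L) (-1)⟩)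
  (hrowT : ∀ L' : EuclideanSpace ℝ (Fin 3) ≃ₗᵢ[ℝ] EuclideanSpace ℝ (Fin 3),
    LocalEndRow WordVersion.v1 sF ⟨L', inPlaneRoots L' 1⟩ ⟨L', inPlaneRoots L' (-1)⟩)
  (hrowB : ∀ (G : EuclideanSpace ℝ (Fin 3) ≃ₗᵢ[ℝ] EuclideanSpace ℝ (Fin 3)) (RT : Finset (EuclideanSpace ℝ (Fin 3))),
    (∀ r ∈ RT, r ∈ fccSlots ∧ 0 < (G r) 2) →
    LocalEndRow WordVersion.v1 sF ⟨G, RT⟩ ⟨G, RT.image (fun r : EuclideanSpace ℝ (Fin 3) => -r)⟩)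
include hg hc hsF hsF'

include hs₀ hcert hfar hrowT hrowB in
open scoped Classical in
/-- **Translation pairs under the rows** (`A₁·Λ₀ = A₂·Λ₀`, `Λ₁ ≠ Λ₂`): the stub's conclusion at `½·sin θ'` for SOME frame,
by the trichotomy (A) non-triadic ⇒ free / (B) axis row / (C) skew-plane row.  See the module docstring. -/
theorem coaxialTwoSlabAdhesion_translate_row
    (A₁ : EuclideanSpace ℝ (Fin 3) ≃ₗᵢ[ℝ] EuclideanSpace ℝ (Fin 3)) (t₁ : EuclideanSpace ℝ (Fin 3))
    (A₂ : EuclideanSpace ℝ (Fin 3) ≃ₗᵢ[ℝ] EuclideanSpace ℝ (Fin 3)) (t₂ : EuclideanSpace ℝ (Fin 3))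
    (hco : ∃ (L : EuclideanSpace ℝ (Fin 3) ≃ₗᵢ[ℝ] EuclideanSpace ℝ (Fin 3))
        (s₁ s₂ : EuclideanSpace ℝ (Fin 3)) (σ σ' : ℤ → ℤ), IsHaggSeq σ ∧ IsHaggSeq σ' ∧
        (fun p => A₁ p + t₁) '' fccStacking 1 (Real.sqrt (2 / 3)) ⊆
          (fun p => L p + s₁) '' barlowStacking 1 (Real.sqrt (2 / 3)) σ ∧
        (fun p => A₂ p + t₂) '' fccStacking 1 (Real.sqrt (2 / 3)) ⊆
          (fun p => L p + s₂) '' barlowStacking 1 (Real.sqrt (2 / 3)) σ')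
    (htrans : A₁ '' fccStacking 1 (Real.sqrt (2 / 3)) = A₂ '' fccStacking 1 (Real.sqrt (2 / 3)))
    (hne : (fun p => A₁ p + t₁) '' fccStacking 1 (Real.sqrt (2 / 3)) ≠
      (fun p => A₂ p + t₂) '' fccStacking 1 (Real.sqrt (2 / 3))) :
    ∃ (L : EuclideanSpace ℝ (Fin 3) ≃ₗᵢ[ℝ] EuclideanSpace ℝ (Fin 3))
        (s₁ s₂ : EuclideanSpace ℝ (Fin 3)) (σ σ' : ℤ → ℤ), IsHaggSeq σ ∧ IsHaggSeq σ' ∧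
        (fun p => A₁ p + t₁) '' fccStacking 1 (Real.sqrt (2 / 3)) ⊆
          (fun p => L p + s₁) '' barlowStacking 1 (Real.sqrt (2 / 3)) σ ∧
        (fun p => A₂ p + t₂) '' fccStacking 1 (Real.sqrt (2 / 3)) ⊆
          (fun p => L p + s₂) '' barlowStacking 1 (Real.sqrt (2 / 3)) σ' ∧
    ∃ C R₀ : ℝ, 1 ≤ R₀ ∧ ∀ h : ℝ, 0 ≤ h → ∀ ρ : ℝ, R₀ ≤ ρ →
      ∀ X P₁ P₂ : Finset (EuclideanSpace ℝ (Fin 3)),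
      (∀ p ∈ X, ∀ q ∈ X, p ≠ q → 1 ≤ dist p q) → P₁ ⊆ X → P₂ ⊆ X \ P₁ →
      (∀ p ∈ X, -(2 * R₀) ≤ p 2 ∧ p 2 ≤ h + 2 * R₀ ∧ p 0 ^ 2 + p 1 ^ 2 ≤ ρ ^ 2) →
      (∀ p, p ∈ P₁ ↔ (p ∈ (fun q => A₁ q + t₁) '' fccStacking 1 (Real.sqrt (2 / 3)) ∧
        -(2 * R₀) ≤ p 2 ∧ p 2 ≤ -R₀ ∧ p 0 ^ 2 + p 1 ^ 2 ≤ ρ ^ 2)) →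
      (∀ p, p ∈ P₂ ↔ (p ∈ (fun q => A₂ q + t₂) '' fccStacking 1 (Real.sqrt (2 / 3)) ∧
        h + R₀ ≤ p 2 ∧ p 2 ≤ h + 2 * R₀ ∧ p 0 ^ 2 + p 1 ^ 2 ≤ ρ ^ 2)) →
      ((((P₁ ×ˢ (X \ P₁)).filter fun pq => dist pq.1 pq.2 = 1).card : ℕ) : ℝ) +
        ((((P₂ ×ˢ ((X \ P₁) \ P₂)).filter fun pq => dist pq.1 pq.2 = 1).card : ℕ) : ℝ) ≤
        contactDeficiency ((X \ P₁) \ P₂) +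
          (Real.sqrt 2 / 4 * ∑ᶠ w ∈ {w ∈ fccStacking 1 (Real.sqrt (2 / 3)) | ‖w‖ = 1},
              |⟪w, A₁.symm (EuclideanSpace.single (2 : Fin 3) (1 : ℝ))⟫_ℝ| +
            Real.sqrt 2 / 4 * ∑ᶠ w ∈ {w ∈ fccStacking 1 (Real.sqrt (2 / 3)) | ‖w‖ = 1},
              |⟪w, A₂.symm (EuclideanSpace.single (2 : Fin 3) (1 : ℝ))⟫_ℝ| -
            (1 / 2 : ℝ) * Real.sqrt (1 - ⟪L (EuclideanSpace.single (2 : Fin 3) (1 : ℝ)),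
              (EuclideanSpace.single (2 : Fin 3) (1 : ℝ))⟫_ℝ ^ 2)) * Real.pi * ρ ^ 2 +
          C * (1 + h) * ρ := by
  set e₃ : EuclideanSpace ℝ (Fin 3) := EuclideanSpace.single (2 : Fin 3) (1 : ℝ) with he₃
  set τ : EuclideanSpace ℝ (Fin 3) := A₁.symm (t₂ - t₁) with hτ
  have hτΛ : τ ∉ fccStacking 1 (Real.sqrt (2 / 3)) := offset_notMem_of_ne A₁ A₂ t₁ t₂ htrans hne
  have hπρ : ∀ ρ : ℝ, 0 ≤ Real.pi * ρ ^ 2 := fun ρ => by positivity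
  have hΛ₂ : A₂ '' fccStacking 1 (Real.sqrt (2 / 3)) = A₁ '' fccStacking 1 (Real.sqrt (2 / 3)) := htrans.symm
  -- `½ ≤ √6/s_F`
  have hhalf : ∀ L' : EuclideanSpace ℝ (Fin 3) ≃ₗᵢ[ℝ] EuclideanSpace ℝ (Fin 3),
      (1 / 2 : ℝ) * Real.sqrt (1 - ⟪L' e₃, e₃⟫_ℝ ^ 2) ≤ Real.sqrt 6 / sF * Real.sqrt (1 - ⟪L' e₃, e₃⟫_ℝ ^ 2) := by
    intro L'
    refine mul_le_mul_of_nonneg_right ?_ (Real.sqrt_nonneg _)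
    rw [le_div_iff₀ hsF]
    linarith only [hsF']
  rcases skew_trichotomy_fin τ with hall | ⟨k, hk⟩ | ⟨c, hcube⟩
  · -- (A) hole cosets: non-triadic, free at `c₀ = 1`
    exact coaxialTwoSlabAdhesion_of_not_triadic hs₀ hcert hfar A₁ t₁ A₂ t₂ hco
      (not_pow_three_smul_mem_of_classA hall hτΛ)
  · -- (B) a doubly skew axis: the four axis roots, the row for the frame `A₁`
    obtain ⟨L', hL', C, R₀, hR₀, hmain⟩ := translate_twoSlabAdhesion_axis_row hg hc A₁ t₁ A₂ t₂ htrans k hk hsF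
      (hrowB A₁)
    refine ⟨L', t₁, t₂, constHagg, constHagg, isHaggSeq_const, isHaggSeq_const,
      movedFcc_subset_frame_of_image_eq A₁ L' t₁ hL'.symm,
      movedFcc_subset_frame_of_image_eq A₂ L' t₂ (hΛ₂.trans hL'.symm), C, R₀, hR₀, ?_⟩
    intro h hh ρ hρ X P₁ P₂ hX hP₁X hP₂X₁ hcyl hP₁ hP₂
    have key := hmain h hh ρ hρ X P₁ P₂ hX hP₁X hP₂X₁ hcyl hP₁ hP₂
    have := mul_le_mul_of_nonneg_right (hhalf L') (hπρ ρ)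
    linarith only [key, this]
  · -- (C) a skew `{111}` plane: the defender's frame `L'`, three in-plane roots, the row for `L'`
    obtain ⟨L', hL', hskew⟩ := exists_skewFrame_of_cube A₁ τ c hcube
    obtain ⟨C, R₀, hR₀, hmain⟩ := coaxialTwoSlabAdhesion_trans_skew_row hg hc A₁ t₁ A₂ t₂ L' hL' htrans hskew hsF
      (hrowT L')
    refine ⟨L', t₁, t₂, constHagg, constHagg, isHaggSeq_const, isHaggSeq_const,
      movedFcc_subset_frame_of_image_eq A₁ L' t₁ hL'.symm,
      movedFcc_subset_frame_of_image_eq A₂ L' t₂ (hΛ₂.trans hL'.symm), C, R₀, hR₀, ?_⟩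
    intro h hh ρ hρ X P₁ P₂ hX hP₁X hP₂X₁ hcyl hP₁ hP₂
    have key := hmain h hh ρ hρ X P₁ P₂ hX hP₁X hP₂X₁ hcyl hP₁ hP₂
    have := mul_le_mul_of_nonneg_right (hhalf L') (hπρ ρ)
    linarith only [key, this]

include hs₀ hcert hfar hrowW hrowT hrowB in
open scoped Classical in
/-- **`stub_coaxialTwoSlabAdhesion`'s statement BY NAME, modulo the named rows** (and `KissingGap`,
`KissingClassification`, E1, `StarPairFar`).  See the module docstring. -/
theorem coaxialTwoSlabAdhesion_of_rows : CoaxialTwoSlabAdhesion := by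
  intro A₁ t₁ A₂ t₂ hcoax hne
  by_cases htrans : A₁ '' fccStacking 1 (Real.sqrt (2 / 3)) = A₂ '' fccStacking 1 (Real.sqrt (2 / 3))
  · exact coaxialTwoSlabAdhesion_translate_row hg hc hs₀ hcert hfar hsF hsF' hrowT hrowB A₁ t₁ A₂ t₂ hcoax htrans hne
  · -- twin pair: frame `L` of the data, the twin rows
    obtain ⟨L, s₁, s₂, σ, σ', hσ, hσ', hsub₁, hsub₂⟩ := hcoax
    set e₃ : EuclideanSpace ℝ (Fin 3) := EuclideanSpace.single (2 : Fin 3) (1 : ℝ) with he₃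
    have hRR : ∀ L' : EuclideanSpace ℝ (Fin 3) ≃ₗᵢ[ℝ] EuclideanSpace ℝ (Fin 3),
        ((ℝ ∙ e₃).reflection).trans (((ℝ ∙ e₃).reflection).trans L') = L' := fun L' =>
      LinearIsometryEquiv.ext fun x => by
        simp only [LinearIsometryEquiv.trans_apply, Submodule.reflection_reflection]
    have hrow : ∀ F : Bool → (EuclideanSpace ℝ (Fin 3) ≃ₗᵢ[ℝ] EuclideanSpace ℝ (Fin 3)),
        (F false = L ∧ F true = ((ℝ ∙ e₃).reflection).trans L ∨
          F false = ((ℝ ∙ e₃).reflection).trans L ∧ F true = L) →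
        LocalEndRow WordVersion.v1 sF ⟨F false, inPlaneRoots (F false) 1⟩ ⟨F true, inPlaneRoots (F true) (-1)⟩ := by
      rintro F (⟨h0, h1⟩ | ⟨h0, h1⟩)
      · rw [h0, h1]; exact hrowW L
      · have := hrowW (((ℝ ∙ e₃).reflection).trans L)
        rw [hRR] at this
        rw [h0, h1]; exact this
    obtain ⟨C, R₀, hR₀, hmain⟩ := coaxialTwoSlabAdhesion_general_twin_of_row hg hc A₁ t₁ A₂ t₂ L s₁ s₂ σ σ'
      hσ hσ' hsub₁ hsub₂ htrans hsF hsF' hrow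
    exact ⟨L, s₁, s₂, σ, σ', hσ, hσ', hsub₁, hsub₂, C, R₀, hR₀, hmain⟩

include hs₀ hcert hfar hrowW hrowT hrowB in
/-- **THE CRUX `CoaxialWallLaw` BY NAME, MODULO THE NAMED ROWS** (and `KissingGap δ`, `KissingClassification δ`, E1,
`StarPairFar`): the skeleton composition `coaxialWallLaw_of_stubProps` with the proved `stub_affineSampleDeficit` and
`coaxialTwoSlabAdhesion_of_rows`.  See the module docstring. -/
theorem coaxialWallLaw_of_rows : Summit.Ventures.Crystal3D.Theses.StickyWulffConstant.CoaxialWallLaw :=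
  coaxialWallLaw_of_stubProps stub_affineSampleDeficit
    (coaxialTwoSlabAdhesion_of_rows hg hc hs₀ hcert hfar hsF hsF' hrowW hrowT hrowB)

include hs₀ hcert hfar hrowW in
/-- **THE CRUX `CoaxialWallLaw` BY NAME, MODULO THE CENSUS PROPS `EndRowTrans v1 s_F`, `EndRowTrans6 v1 s_F`** (and the
twin rows in half-turn form, `KissingGap δ`, `KissingClassification δ`, E1, `StarPairFar`).  See the module docstring. -/
theorem coaxialWallLaw_of_endRows (hT : EndRowTrans WordVersion.v1 sF) (h6 : EndRowTrans6 WordVersion.v1 sF) :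
    Summit.Ventures.Crystal3D.Theses.StickyWulffConstant.CoaxialWallLaw :=
  coaxialWallLaw_of_rows hg hc hs₀ hcert hfar hsF hsF' hrowW hT (localEndRow_of_endRowTrans6 h6)

end Rows

end Summit.Ventures.Crystal3D.Theorems

end
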